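import Literature.AnabelianGeometry.AbsoluteAnabelian.AbsTopICharacterRankCyclotomicModel
import HarnessLib

/-!
# [AbsTopI] Lemma 4.5 (iii) at the SPLIT MIXED-WEIGHT MODULE `V(ψ) ⊕ K(χ^{cyclo})`, `ψ² = χ^{cyclo}` —
# a model witness with realised weights `{0, 1, 2}`

Proof-only companion of `AbsTopICharacterRank.lean` (S. Mochizuki, *Topics in Absolute Anabelian
Geometry I: Generalities* [MochizukiAbsTopI2012], Lemma 4.5 (iii), kurims manuscript p. 54) and of the
statements-first sub-DAG `AbsTopICuspidalDecompositionSub.lean` ([CombGC] Prop. 2.4 (iii)/(vii)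
pp. 19–20, proof of Cor. 2.7 (i) p. 23).  Cell abc-iut, block F, seat abc-iut-f-062 (FACT-LIST rows
F-0222 `Lem45iii_cuspCount`, F-0223 `Lem45iii_cycloClass`, F-0224 `Lem45iii_det`, F-0225
`RealisedWeight`); sequel to `AbsTopICharacterRankCyclotomicModel.lean` (the pure weight-`2` module).

There the realised-weight set was `{0, 2}` (print's symmetry `λ ↦ 2 − λ`, [CombGC] Prop. 2.4 (vii),
only swaps the endpoints).  THIS FILE treats the shape print predicts for genus `g ≥ 1` with `r = 2`
cusps — `H^{ab} ⊗ ℚ_l ≅ V_l(J) ⊕ ℚ_l(1)`, weights `1` and `2` — in its simplest algebraic form: the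
**split module** `M = V(ψ) ⊕ K(χ^{cyclo})` on `V × K`, `V` (`dim V > 0`) carrying the scalar action of
a character `ψ` with `ψ² = χ^{cyclo}` (weight `1`), the line carrying `χ^{cyclo}`; assembled from the
trunk's constructors as `twist (withTrivial (twist 1 (ψ·(χ^{cyclo})⁻¹))) χ^{cyclo}` — NO new definition
(statements take any `ρM` EQUAL to this term).  For NON-DEGENERATE `χ^{cyclo}`:
`quasiTrivialRank_splitModel_twist` (`τ(M(θ)) = dim V·[ψθ ≡ 1] + [χ^{cyclo}θ ≡ 1]`, "`≡ 1`" = trivial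
on an open subgroup of finite index); `realisedWeight_splitModel_iff` (realised weights EXACTLY
`{0, 1, 2}`: a `ℚ`-cyclotomic `θ` agreeing with `ψ` on such a subgroup has weight `1`), hence A7
`realisedWeightsSymmetric_splitModel` (middle weight FIXED, endpoints SWAPPED); `detChar_splitModel`
(`det = ψ^{dim V}·χ^{cyclo}`) hence A3 `detSqQuasiCyclotomic_splitModel` (`det² = (χ^{cyclo})^{dim V+2}`);
A9 `cuspCountViaWeights_splitModel` (`1 − 0 + 1 = 2 = r`); so `lem45iii_det_splitModel`,
`lem45iii_cycloClass_splitModel`, `lem45iii_cuspCount_splitModel`; CLOSED instance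
`Int42Model.lem45iii_all` (`G = Multiplicative ℤ`, `K = ℚ`, `χ^{cyclo}(n) = 4ⁿ`, `ψ(n) = 2ⁿ`, `V = ℚ²`;
`nondegenerate_zpowersHom`: `n ↦ xⁿ` is non-degenerate for `1 < x`).
HONEST FRAMING: an ALGEBRAIC model — consistency / non-vacuity evidence for the typed predicates and
for the joint satisfiability of A3, A7, A9 with three distinct weights; NOT constructed from a curve
(in particular the weight-`1` part is `ψ`-isotypic, unlike a genuine `V_l(J)`); refereed pre-IUT
anabelian geometry; nothing here bears on [IUTchIII] Cor. 3.12.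
-/

noncomputable section

open scoped Classical

namespace Literature.AnabelianGeometry.AbsoluteAnabelian.AbsTopI

universe u v w'

section SplitModel

variable {G : Type u} [Group G] [TopologicalSpace G]
variable {K : Type v} [Field K]
variable {V : Type w'} [AddCommGroup V] [Module K V]

/-! ### Characters trivial on an open subgroup of finite index: bookkeeping under `ψ² = χ^{cyclo}` -/

/-- A non-degenerate character is not trivial on any open subgroup of finite index.
[cite: MochizukiAbsTopI2012, Lemma 4.5 (iii) p.54] -/
theorem not_trivialOn_of_nondegenerate (χcyclo : G →* Kˣ)
    (hcyc : ∀ U : Subgroup G, IsOpen (U : Set G) → U.FiniteIndex →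
      ∀ a : ℤ, a ≠ 0 → ∃ g ∈ U, χcyclo g ^ a ≠ 1) :
    ¬ ∃ U : Subgroup G, IsOpen (U : Set G) ∧ U.FiniteIndex ∧ ∀ g ∈ U, χcyclo g = 1 := by
  rintro ⟨U, hU, hfi, hact⟩
  obtain ⟨g, hg, hne⟩ := hcyc U hU hfi 1 one_ne_zero
  exact hne (by rw [zpow_one, hact g hg])

/-- A square root `ψ` of a non-degenerate `χ^{cyclo}` is nowhere locally trivial. [cite: MochizukiAbsTopI2012, Lemma 4.5 (iii) p.54] -/
theorem not_trivialOn_sqrt {χcyclo ψ : G →* Kˣ} (hψ : ∀ g : G, ψ g ^ 2 = χcyclo g)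
    (hcyc : ∀ U : Subgroup G, IsOpen (U : Set G) → U.FiniteIndex →
      ∀ a : ℤ, a ≠ 0 → ∃ g ∈ U, χcyclo g ^ a ≠ 1) :
    ¬ ∃ U : Subgroup G, IsOpen (U : Set G) ∧ U.FiniteIndex ∧ ∀ g ∈ U, ψ g = 1 := by
  rintro ⟨U, hU, hfi, hact⟩
  obtain ⟨g, hg, hne⟩ := hcyc U hU hfi 1 one_ne_zero
  exact hne (by rw [zpow_one, ← hψ g, hact g hg, one_pow])

/-- `ψ·(χ^{cyclo})⁻¹` is nowhere locally trivial (else `χ^{cyclo} = ψ² ≡ (χ^{cyclo})²`). [cite: MochizukiAbsTopI2012, Lemma 4.5 (iii) p.54] -/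
theorem not_trivialOn_sqrt_mul_inv {χcyclo ψ : G →* Kˣ} (hψ : ∀ g : G, ψ g ^ 2 = χcyclo g)
    (hcyc : ∀ U : Subgroup G, IsOpen (U : Set G) → U.FiniteIndex →
      ∀ a : ℤ, a ≠ 0 → ∃ g ∈ U, χcyclo g ^ a ≠ 1) :
    ¬ ∃ U : Subgroup G, IsOpen (U : Set G) ∧ U.FiniteIndex ∧ ∀ g ∈ U, (ψ * χcyclo⁻¹) g = 1 := by
  rintro ⟨U, hU, hfi, hact⟩
  obtain ⟨g, hg, hne⟩ := hcyc U hU hfi 1 one_ne_zero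
  have hψg : ψ g = χcyclo g := by
    have := hact g hg
    rwa [MonoidHom.mul_apply, MonoidHom.inv_apply, mul_inv_eq_one] at this
  apply hne
  have h2 : χcyclo g ^ 2 = χcyclo g := ((congrArg (· ^ 2) hψg).symm.trans (hψ g) :)
  rw [zpow_one]
  calc χcyclo g = χcyclo g ^ 2 * (χcyclo g)⁻¹ := by rw [pow_two, mul_inv_cancel_right]
    _ = 1 := by rw [h2, mul_inv_cancel]

/-- A `ℚ`-cyclotomic `θ` (`θ^b = (χ^{cyclo})^a`) agreeing with the square root `ψ` on an open subgroup
of finite index has weight `1` (`ψ^{2b} = χ^b = χ^{2a}` there forces `b = 2a`).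
[cite: MochizukiCombGC2007, Def. 2.3 (ii) p.18] [cite: MochizukiAbsTopI2012, Lemma 4.5 (iii) p.54] -/
theorem weight_eq_one_of_trivialOn_sqrt_mul_inv {χcyclo ψ θ : G →* Kˣ} {w : ℚ}
    (hψ : ∀ g : G, ψ g ^ 2 = χcyclo g)
    (hcyc : ∀ U : Subgroup G, IsOpen (U : Set G) → U.FiniteIndex →
      ∀ a : ℤ, a ≠ 0 → ∃ g ∈ U, χcyclo g ^ a ≠ 1)
    (hθ : IsQCyclotomicOfWeightK χcyclo θ w)
    (hU : ∃ U : Subgroup G, IsOpen (U : Set G) ∧ U.FiniteIndex ∧ ∀ g ∈ U, (ψ * θ⁻¹) g = 1) :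
    w = 1 := by
  obtain ⟨a, b, hb, hab, hw⟩ := hθ
  obtain ⟨U, hUo, hfi, hact⟩ := hU
  have hb2a : b = 2 * a := by
    by_contra hne
    obtain ⟨g, hg, hg1⟩ := hcyc U hUo hfi (b - 2 * a) (sub_ne_zero.2 hne)
    have hθg : θ g = ψ g := by
      have := hact g hg
      rw [MonoidHom.mul_apply, MonoidHom.inv_apply, mul_inv_eq_one] at this
      exact this.symm
    apply hg1
    have hsq : (χcyclo g : Kˣ) = ψ g ^ (2 : ℤ) := by rw [← hψ g]; norm_cast
    have key : χcyclo g ^ b = χcyclo g ^ (2 * a) := by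
      calc χcyclo g ^ b = (ψ g ^ (2 : ℤ)) ^ b := by rw [hsq]
        _ = (ψ g ^ b) ^ (2 : ℤ) := by rw [← zpow_mul, ← zpow_mul, mul_comm]
        _ = (χcyclo g ^ a) ^ (2 : ℤ) := by rw [← hθg, hab g]
        _ = χcyclo g ^ (2 * a) := by rw [← zpow_mul, mul_comm]
    rw [zpow_sub, key, mul_inv_cancel]
  subst hb2a
  have ha : (a : ℚ) ≠ 0 := by exact_mod_cast (show a ≠ 0 by omega)
  rw [hw]
  push_cast
  field_simp

/-- A `ℚ`-cyclotomic `θ` agreeing with `χ^{cyclo}` on an open subgroup of finite index has weight `2`.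
[cite: MochizukiCombGC2007, Def. 2.3 (ii) p.18] [cite: MochizukiAbsTopI2012, Lemma 4.5 (iii) p.54] -/
theorem weight_eq_two_of_trivialOn_mul_inv {χcyclo θ : G →* Kˣ} {w : ℚ}
    (hcyc : ∀ U : Subgroup G, IsOpen (U : Set G) → U.FiniteIndex →
      ∀ a : ℤ, a ≠ 0 → ∃ g ∈ U, χcyclo g ^ a ≠ 1)
    (hθ : IsQCyclotomicOfWeightK χcyclo θ w)
    (hU : ∃ U : Subgroup G, IsOpen (U : Set G) ∧ U.FiniteIndex ∧ ∀ g ∈ U, (χcyclo * θ⁻¹) g = 1) :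
    w = 2 := by
  obtain ⟨a, b, hb, hab, hw⟩ := hθ
  obtain ⟨U, hUo, hfi, hact⟩ := hU
  have hab' : a = b := by
    by_contra hne'
    obtain ⟨g, hg, hg1⟩ := hcyc U hUo hfi (b - a) (sub_ne_zero.2 (Ne.symm hne'))
    have hθg : θ g = χcyclo g := by
      have := hact g hg
      rw [MonoidHom.mul_apply, MonoidHom.inv_apply, mul_inv_eq_one] at this
      exact this.symm
    apply hg1
    rw [zpow_sub, ← hθg, hab g, hθg, mul_inv_cancel]
  rw [hw, hab']
  have hbq : (b : ℚ) ≠ 0 := by exact_mod_cast hb.ne'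
  field_simp

/-! ### The split module `M = V(ψ) ⊕ K(χ^{cyclo})` and its twists -/

variable {χcyclo ψ : G →* Kˣ} {ρM : G →* ((V × K) ≃ₗ[K] (V × K))}

omit [TopologicalSpace G] in
/-- The split module, evaluated: `g ↦ (ψ(g)·v, χ^{cyclo}(g)·c)`.
[cite: MochizukiAbsTopI2012, Lemma 4.5 (iii) p.54] -/
theorem splitModel_apply
    (hM : ρM = twist (withTrivial (twist (1 : G →* (V ≃ₗ[K] V)) (ψ * χcyclo⁻¹))) χcyclo)
    (g : G) (x : V × K) : ρM g x = ((ψ g : K) • x.1, (χcyclo g : K) • x.2) := by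
  rw [hM, twist_withTrivial_apply, twist_one_smul_apply, smul_smul]
  congr 1
  rw [MonoidHom.mul_apply, MonoidHom.inv_apply, ← Units.val_mul, mul_comm (ψ g) (χcyclo g)⁻¹,
    mul_inv_cancel_left]

/-- **`τ(M(θ)) = dim V·[ψθ ≡ 1] + [χ^{cyclo}θ ≡ 1]`** (additivity over `V ⊕ K`; scalar and line formulas). [cite: MochizukiAbsTopI2012, Lemma 4.5 (ii) p.54] -/
theorem quasiTrivialRank_splitModel_twist [FiniteDimensional K V]
    (hM : ρM = twist (withTrivial (twist (1 : G →* (V ≃ₗ[K] V)) (ψ * χcyclo⁻¹))) χcyclo)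
    (θ : G →* Kˣ) :
    quasiTrivialRank (twist ρM θ) =
      (if ∃ U : Subgroup G, IsOpen (U : Set G) ∧ U.FiniteIndex ∧ ∀ g ∈ U, (ψ * θ) g = 1
        then Module.finrank K V else 0) +
      (if ∃ U : Subgroup G, IsOpen (U : Set G) ∧ U.FiniteIndex ∧ ∀ g ∈ U, (χcyclo * θ) g = 1
        then 1 else 0) := by
  have e : ψ * χcyclo⁻¹ * (χcyclo * θ) = ψ * θ := MonoidHom.ext fun g => by
    simp only [MonoidHom.mul_apply, MonoidHom.inv_apply]
    rw [mul_assoc, inv_mul_cancel_left]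
  rw [hM, twist_twist, quasiTrivialRank_twist_withTrivial, twist_twist_one, e,
    quasiTrivialRank_twist_one_smul, quasiTrivialRank_twist_one]

/-- `τ(M) = 0`: neither `ψ` nor `χ^{cyclo}` is locally trivial (no weight-`0` part). [cite: MochizukiAbsTopI2012, Lemma 4.5 (ii) p.54] -/
theorem quasiTrivialRank_splitModel [FiniteDimensional K V]
    (hM : ρM = twist (withTrivial (twist (1 : G →* (V ≃ₗ[K] V)) (ψ * χcyclo⁻¹))) χcyclo)
    (hψ : ∀ g : G, ψ g ^ 2 = χcyclo g)
    (hcyc : ∀ U : Subgroup G, IsOpen (U : Set G) → U.FiniteIndex →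
      ∀ a : ℤ, a ≠ 0 → ∃ g ∈ U, χcyclo g ^ a ≠ 1) :
    quasiTrivialRank ρM = 0 := by
  have h := quasiTrivialRank_splitModel_twist hM (1 : G →* Kˣ)
  simp only [twist_one, MonoidHom.mul_apply, MonoidHom.one_apply, mul_one] at h
  rw [if_neg (not_trivialOn_sqrt hψ hcyc), if_neg (not_trivialOn_of_nondegenerate χcyclo hcyc)] at h
  exact h

/-- `τ(M((χ^{cyclo})⁻¹)) = 1`: only the line `K(χ^{cyclo})` untwists to a trivial action.
[cite: MochizukiAbsTopI2012, Lemma 4.5 (ii) p.54] -/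
theorem quasiTrivialRank_splitModel_twist_inv [FiniteDimensional K V]
    (hM : ρM = twist (withTrivial (twist (1 : G →* (V ≃ₗ[K] V)) (ψ * χcyclo⁻¹))) χcyclo)
    (hψ : ∀ g : G, ψ g ^ 2 = χcyclo g)
    (hcyc : ∀ U : Subgroup G, IsOpen (U : Set G) → U.FiniteIndex →
      ∀ a : ℤ, a ≠ 0 → ∃ g ∈ U, χcyclo g ^ a ≠ 1) :
    quasiTrivialRank (twist ρM χcyclo⁻¹) = 1 := by
  rw [quasiTrivialRank_splitModel_twist hM, if_neg (not_trivialOn_sqrt_mul_inv hψ hcyc), if_pos,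
    zero_add]
  exact ⟨⊤, isOpen_univ, inferInstance, fun g _ => by simp⟩

/-! ### The realised weights of `M` are exactly `{0, 1, 2}` (A7 holds, non-trivially) -/

omit [TopologicalSpace G] in
/-- `ψ` is `ℚ`-cyclotomic of weight `1` (`a = 1`, `b = 2`). [cite: MochizukiCombGC2007, Def. 2.3 (ii) p.18] -/
theorem isQCyclotomicOfWeightK_sqrt_one (hψ : ∀ g : G, ψ g ^ 2 = χcyclo g) :
    IsQCyclotomicOfWeightK χcyclo ψ 1 :=
  ⟨1, 2, two_pos, fun g => by rw [zpow_one, ← hψ g]; norm_cast, by norm_num⟩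

/-- **The weights realised by `M ⊕ K` are exactly `0`, `1`, `2`** (for non-degenerate `χ^{cyclo}`,
`ψ² = χ^{cyclo}`, `dim V > 0`) — print's "`{0} ∪ w_l(M)`" with `w_l(M) = {1, 2}`.
[cite: MochizukiCombGC2007, Prop. 2.4 (vii) p.20] [cite: MochizukiAbsTopI2012, Lemma 4.5 (iii) p.54] -/
theorem realisedWeight_splitModel_iff [FiniteDimensional K V]
    (hM : ρM = twist (withTrivial (twist (1 : G →* (V ≃ₗ[K] V)) (ψ * χcyclo⁻¹))) χcyclo)
    (hψ : ∀ g : G, ψ g ^ 2 = χcyclo g)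
    (hcyc : ∀ U : Subgroup G, IsOpen (U : Set G) → U.FiniteIndex →
      ∀ a : ℤ, a ≠ 0 → ∃ g ∈ U, χcyclo g ^ a ≠ 1)
    (hd : 0 < Module.finrank K V) (w : ℚ) :
    RealisedWeight χcyclo ρM w ↔ w = 0 ∨ w = 1 ∨ w = 2 := by
  rw [realisedWeight_iff_zero_or χcyclo hcyc]
  refine or_congr_right ?_
  constructor
  · rintro ⟨θ, hθ, hne⟩
    rw [quasiTrivialRank_splitModel_twist hM] at hne
    by_cases h1 : ∃ U : Subgroup G, IsOpen (U : Set G) ∧ U.FiniteIndex ∧ ∀ g ∈ U, (ψ * θ⁻¹) g = 1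
    · exact Or.inl (weight_eq_one_of_trivialOn_sqrt_mul_inv hψ hcyc hθ h1)
    · by_cases h2 : ∃ U : Subgroup G, IsOpen (U : Set G) ∧ U.FiniteIndex ∧
          ∀ g ∈ U, (χcyclo * θ⁻¹) g = 1
      · exact Or.inr (weight_eq_two_of_trivialOn_mul_inv hcyc hθ h2)
      · rw [if_neg h1, if_neg h2] at hne
        exact absurd rfl hne
  · rintro (rfl | rfl)
    · refine ⟨ψ, isQCyclotomicOfWeightK_sqrt_one hψ, ?_⟩
      rw [quasiTrivialRank_splitModel_twist hM, if_pos ⟨⊤, isOpen_univ, inferInstance, fun g _ => by simp⟩]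
      omega
    · refine ⟨χcyclo, (cycloWeightTwoTrivialWeightZero_holds χcyclo).1, ?_⟩
      rw [quasiTrivialRank_splitModel_twist hM,
        if_pos (show ∃ U : Subgroup G, IsOpen (U : Set G) ∧ U.FiniteIndex ∧
          ∀ g ∈ U, (χcyclo * χcyclo⁻¹) g = 1 from ⟨⊤, isOpen_univ, inferInstance, fun g _ => by simp⟩)]
      omega

/-- **A7 at the split model** ([CombGC] Prop. 2.4 (vii)): `{0, 1, 2}` is finite and invariant under
`λ ↦ 2 − λ` — the endpoints are swapped, the middle weight is fixed.
[cite: MochizukiCombGC2007, Prop. 2.4 (vii) p.20] [cite: MochizukiAbsTopI2012, Lemma 4.5 (iii) p.54] -/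
theorem realisedWeightsSymmetric_splitModel [FiniteDimensional K V]
    (hM : ρM = twist (withTrivial (twist (1 : G →* (V ≃ₗ[K] V)) (ψ * χcyclo⁻¹))) χcyclo)
    (hψ : ∀ g : G, ψ g ^ 2 = χcyclo g)
    (hcyc : ∀ U : Subgroup G, IsOpen (U : Set G) → U.FiniteIndex →
      ∀ a : ℤ, a ≠ 0 → ∃ g ∈ U, χcyclo g ^ a ≠ 1)
    (hd : 0 < Module.finrank K V) : RealisedWeightsSymmetric χcyclo ρM := by
  have hset : {w : ℚ | RealisedWeight χcyclo ρM w} = {0, 1, 2} := by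
    ext w
    rw [Set.mem_setOf_eq, realisedWeight_splitModel_iff hM hψ hcyc hd]
    simp
  refine ⟨by rw [hset]; exact Set.toFinite _, fun w => ?_⟩
  rw [realisedWeight_splitModel_iff hM hψ hcyc hd, realisedWeight_splitModel_iff hM hψ hcyc hd]
  constructor
  · rintro (rfl | rfl | rfl) <;> norm_num
  · rintro (h | h | h)
    · right; right; linarith
    · right; left; linarith
    · left; linarith

/-! ### The determinant character `det M = ψ^{dim V}·χ^{cyclo}` (A3 holds) -/

omit [TopologicalSpace G] in
/-- `det(M(g)) = ψ(g)^{dim V}·χ^{cyclo}(g)`. [cite: MochizukiAbsTopI2012, Lemma 4.5 (iii) p.54] -/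
theorem detChar_splitModel [FiniteDimensional K V]
    (hM : ρM = twist (withTrivial (twist (1 : G →* (V ≃ₗ[K] V)) (ψ * χcyclo⁻¹))) χcyclo) (g : G) :
    detChar ρM g = ψ g ^ Module.finrank K V * χcyclo g := by
  apply Units.ext
  have hlin : ((ρM g : (V × K) ≃ₗ[K] (V × K)) : (V × K) →ₗ[K] (V × K)) =
      (((ψ g : K) • LinearMap.id : V →ₗ[K] V)).prodMap ((χcyclo g : K) • LinearMap.id : K →ₗ[K] K) := by
    ext x <;> simp [splitModel_apply hM]
  show ((LinearEquiv.det (ρM g) : Kˣ) : K) = _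
  rw [LinearEquiv.coe_det, hlin, LinearMap.det_prodMap, LinearMap.det_smul, LinearMap.det_smul,
    LinearMap.det_id, LinearMap.det_id, mul_one, mul_one, Module.finrank_self, pow_one, Units.val_mul,
    Units.val_pow_eq_pow_val]

/-- **A3 at the split model** ([CombGC] Prop. 2.4 (iii)): `det² = ψ^{2·dim V}·(χ^{cyclo})² =
(χ^{cyclo})^{dim V + 2}` on all of `G`, with `0 < dim V + 2 ≤ 2·dim M = 2·(dim V + 1)`.
[cite: MochizukiCombGC2007, Prop. 2.4 (iii) p.19] [cite: MochizukiAbsTopI2012, Lemma 4.5 (iii) p.54] -/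
theorem detSqQuasiCyclotomic_splitModel [FiniteDimensional K V]
    (hM : ρM = twist (withTrivial (twist (1 : G →* (V ≃ₗ[K] V)) (ψ * χcyclo⁻¹))) χcyclo)
    (hψ : ∀ g : G, ψ g ^ 2 = χcyclo g) : DetSqQuasiCyclotomic χcyclo ρM := by
  refine ⟨Module.finrank K V + 2, by omega, ?_, ⊤, isOpen_univ, inferInstance, fun g _ => ?_⟩
  · rw [Module.finrank_prod, Module.finrank_self]
    omega
  · rw [detChar_splitModel hM, mul_pow, ← pow_mul, mul_comm (Module.finrank K V) 2, pow_mul, hψ g,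
      ← pow_add]

/-! ### A9 and the three sentences of Lemma 4.5 (iii) at the split model -/

/-- **A9 at the split model** ([CombGC] proof of Cor. 2.7 (i)): with `r = 2` cusps,
`τ(M((χ^{cyclo})⁻¹)) − τ(M) + 1 = 1 − 0 + 1 = 2`.
[cite: MochizukiCombGC2007, Cor. 2.7 (i) proof p.23] [cite: MochizukiAbsTopI2012, Lemma 4.5 (iii) p.54] -/
theorem cuspCountViaWeights_splitModel [FiniteDimensional K V]
    (hM : ρM = twist (withTrivial (twist (1 : G →* (V ≃ₗ[K] V)) (ψ * χcyclo⁻¹))) χcyclo)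
    (hψ : ∀ g : G, ψ g ^ 2 = χcyclo g)
    (hcyc : ∀ U : Subgroup G, IsOpen (U : Set G) → U.FiniteIndex →
      ∀ a : ℤ, a ≠ 0 → ∃ g ∈ U, χcyclo g ^ a ≠ 1) :
    CuspCountViaWeights χcyclo ρM 2 := by
  unfold CuspCountViaWeights
  rw [quasiTrivialRank_splitModel_twist_inv hM hψ hcyc, quasiTrivialRank_splitModel hM hψ hcyc]
  norm_num

/-- **F-0224 at the split model** (via A3 ⇒ A4): `det = ψ^{dim V}·χ^{cyclo}` is `ℚ`-cyclotomic of positive weight. [cite: MochizukiAbsTopI2012, Lemma 4.5 (iii) p.54] -/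
theorem lem45iii_det_splitModel [FiniteDimensional K V]
    (hM : ρM = twist (withTrivial (twist (1 : G →* (V ≃ₗ[K] V)) (ψ * χcyclo⁻¹))) χcyclo)
    (hψ : ∀ g : G, ψ g ^ 2 = χcyclo g) : Lem45iii_det χcyclo ρM :=
  detQCyclotomicOfDetSq_holds χcyclo _ (detSqQuasiCyclotomic_splitModel hM hψ)

/-- **F-0223 at the split model** (via A7 ⇒ A8): max weight `2`, min weight `0`, every `χ^*·χ_*`
power-equivalent to `χ^{cyclo}` — at data with THREE realised weights.
[cite: MochizukiAbsTopI2012, Lemma 4.5 (iii) p.54] [cite: MochizukiCombGC2007, Prop. 2.4 (vii) p.20] -/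
theorem lem45iii_cycloClass_splitModel [FiniteDimensional K V]
    (hM : ρM = twist (withTrivial (twist (1 : G →* (V ≃ₗ[K] V)) (ψ * χcyclo⁻¹))) χcyclo)
    (hψ : ∀ g : G, ψ g ^ 2 = χcyclo g)
    (hcyc : ∀ U : Subgroup G, IsOpen (U : Set G) → U.FiniteIndex →
      ∀ a : ℤ, a ≠ 0 → ∃ g ∈ U, χcyclo g ^ a ≠ 1)
    (hd : 0 < Module.finrank K V) : Lem45iii_cycloClass χcyclo ρM :=
  lem45iii_cycloClass_of_realisedWeightsSymmetric χcyclo _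
    (realisedWeightsSymmetric_splitModel hM hψ hcyc hd)

/-- **F-0222 at the split model** (via A9 ∧ A10 ⇒ A11): `numCusps = d_χ(M) + 1 = 2`. [cite: MochizukiAbsTopI2012, Lemma 4.5 (iii) p.54] -/
theorem lem45iii_cuspCount_splitModel [FiniteDimensional K V]
    (hM : ρM = twist (withTrivial (twist (1 : G →* (V ≃ₗ[K] V)) (ψ * χcyclo⁻¹))) χcyclo)
    (hψ : ∀ g : G, ψ g ^ 2 = χcyclo g)
    (hcyc : ∀ U : Subgroup G, IsOpen (U : Set G) → U.FiniteIndex →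
      ∀ a : ℤ, a ≠ 0 → ∃ g ∈ U, χcyclo g ^ a ≠ 1) :
    Lem45iii_cuspCount χcyclo ρM 2 :=
  cuspCountOfWeights_holds χcyclo _ _ (cuspCountViaWeights_splitModel hM hψ hcyc) (dualRankEq_holds _)

end SplitModel

/-! ### A closed instance: `G = ℤ`, `K = ℚ`, `χ^{cyclo}(n) = 4ⁿ`, `ψ(n) = 2ⁿ`, `V = ℚ²` -/

/-- **Non-degeneracy of `n ↦ xⁿ` on `ℤ` for `1 < x` in `ℚ`**: no nonzero power is trivial on a
subgroup of finite index (such a subgroup contains some `n ≠ 0`, and `x^{na} ≠ 1`).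
[cite: MochizukiAbsTopI2012, Lemma 4.5 (iii) p.54] -/
theorem nondegenerate_zpowersHom {x : ℚ} (hx : 1 < x) :
    ∀ U : Subgroup (Multiplicative ℤ), IsOpen (U : Set (Multiplicative ℤ)) → U.FiniteIndex →
      ∀ a : ℤ, a ≠ 0 → ∃ g ∈ U, (zpowersHom ℚˣ (Units.mk0 x (by positivity))) g ^ a ≠ 1 := by
  intro U _ hfi a ha
  have hU : U ≠ ⊥ := by
    rintro rfl
    apply hfi.index_ne_zero
    rw [Subgroup.index_bot]
    exact Nat.card_eq_zero_of_infinite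
  obtain ⟨g, hgU, hg1⟩ := (Subgroup.bot_or_exists_ne_one U).resolve_left hU
  refine ⟨g, hgU, fun h => ?_⟩
  have hn : g.toAdd ≠ 0 := fun h0 => hg1 (by simpa using congrArg Multiplicative.ofAdd h0)
  have h' := congrArg (fun u : ℚˣ => (u : ℚ)) h
  simp only [Units.val_zpow_eq_zpow_val, zpowersHom_apply, Units.val_mk0, Units.val_one,
    ← zpow_mul] at h'
  have hinj := zpow_right_injective₀ (a := x) (by positivity) hx.ne'
  have h0 : g.toAdd * a = 0 := hinj (by simpa using h')
  rcases mul_eq_zero.1 h0 with h0 | h0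
  · exact hn h0
  · exact ha h0

namespace Int42Model

/-- `(2ⁿ)² = 4ⁿ`: `ψ = 2ⁿ` is a square root of `χ^{cyclo} = 4ⁿ`. [cite: MochizukiAbsTopI2012, Lemma 4.5 (iii) p.54] -/
theorem psi_sq (g : Multiplicative ℤ) :
    (zpowersHom ℚˣ (Units.mk0 (2 : ℚ) (by positivity))) g ^ 2 =
      (zpowersHom ℚˣ (Units.mk0 (4 : ℚ) (by positivity))) g := by
  have h4 : Units.mk0 (4 : ℚ) (by positivity) =
      Units.mk0 (2 : ℚ) (by positivity) * Units.mk0 (2 : ℚ) (by positivity) := by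
    ext; norm_num
  rw [zpowersHom_apply, zpowersHom_apply, h4, mul_zpow, sq]

/-- **[AbsTopI] Lemma 4.5 (iii) at a CLOSED split model** (`G = ℤ` written multiplicatively, `K = ℚ`,
`χ^{cyclo}(n) = 4ⁿ`, `ψ(n) = 2ⁿ`, `M = ℚ²(ψ) ⊕ ℚ(χ^{cyclo})` — the shape of `V_l(E) ⊕ ℚ_l(1)` for a
twice-punctured elliptic curve, `g = 1`, `r = 2`; `ρM` is pinned to the model term by `hM`): A3, A7
(realised weights exactly `{0, 1, 2}`), A9 and `Lem45iii_det`, `Lem45iii_cycloClass`,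
`Lem45iii_cuspCount … 2` all hold.  Consistency evidence; not a curve.
[cite: MochizukiAbsTopI2012, Lemma 4.5 (iii) p.54] [cite: MochizukiCombGC2007, Cor. 2.7 (i) proof p.23] -/
theorem lem45iii_all (ρM : Multiplicative ℤ →* (((Fin 2 → ℚ) × ℚ) ≃ₗ[ℚ] ((Fin 2 → ℚ) × ℚ)))
    (hM : ρM = twist (withTrivial (twist (1 : Multiplicative ℤ →* ((Fin 2 → ℚ) ≃ₗ[ℚ] (Fin 2 → ℚ)))
      (zpowersHom ℚˣ (Units.mk0 (2 : ℚ) (by positivity)) *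
        (zpowersHom ℚˣ (Units.mk0 (4 : ℚ) (by positivity)))⁻¹)))
      (zpowersHom ℚˣ (Units.mk0 (4 : ℚ) (by positivity)))) :
    DetSqQuasiCyclotomic (zpowersHom ℚˣ (Units.mk0 (4 : ℚ) (by positivity))) ρM ∧
      RealisedWeightsSymmetric (zpowersHom ℚˣ (Units.mk0 (4 : ℚ) (by positivity))) ρM ∧
      (∀ w : ℚ, RealisedWeight (zpowersHom ℚˣ (Units.mk0 (4 : ℚ) (by positivity))) ρM w ↔
        w = 0 ∨ w = 1 ∨ w = 2) ∧
      CuspCountViaWeights (zpowersHom ℚˣ (Units.mk0 (4 : ℚ) (by positivity))) ρM 2 ∧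
      Lem45iii_det (zpowersHom ℚˣ (Units.mk0 (4 : ℚ) (by positivity))) ρM ∧
      Lem45iii_cycloClass (zpowersHom ℚˣ (Units.mk0 (4 : ℚ) (by positivity))) ρM ∧
      Lem45iii_cuspCount (zpowersHom ℚˣ (Units.mk0 (4 : ℚ) (by positivity))) ρM 2 := by
  have hd : 0 < Module.finrank ℚ (Fin 2 → ℚ) := by simp
  have hcyc := nondegenerate_zpowersHom (x := (4 : ℚ)) (by norm_num)
  exact ⟨detSqQuasiCyclotomic_splitModel hM psi_sq, realisedWeightsSymmetric_splitModel hM psi_sq hcyc hd,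
    realisedWeight_splitModel_iff hM psi_sq hcyc hd, cuspCountViaWeights_splitModel hM psi_sq hcyc,
    lem45iii_det_splitModel hM psi_sq, lem45iii_cycloClass_splitModel hM psi_sq hcyc hd,
    lem45iii_cuspCount_splitModel hM psi_sq hcyc⟩

end Int42Model

end Literature.AnabelianGeometry.AbsoluteAnabelian.AbsTopI

end
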